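import Summits.ResolutionOfSingularities.ResolutionOfSingularities.Theorems.FrobeniusLadderFInjectiveMacaulayficationPrimaryRegularLocFixOfIsolated
import Summits.ResolutionOfSingularities.ResolutionOfSingularities.Theorems.FrobeniusLadderFInjectiveMacaulayficationSpreadSupportControl
import Summits.ResolutionOfSingularities.ResolutionOfSingularities.Theorems.FrobeniusLadderFInjectiveMacaulayficationAbsorbingStep
import Summits.ResolutionOfSingularities.ResolutionOfSingularities.Theorems.FrobeniusLadderFInjectiveMacaulayficationClosedPointsOfClosedFinite
import Summits.ResolutionOfSingularities.ResolutionOfSingularities.Theorems.FrobeniusLadderFInjectiveMacaulayficationRegularPointClause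
import HarnessLib

/-!
# FC″ at an ISOLATED-SINGULARITY CURVE GERM: the finite-residual hypothesis of `FCUnguardedOfFiniteResidualR` SUPPLIED
# (crux `FInjectiveMacaulayfication` stmt-ResolutionOfSingularities-15315, chain w45a; res-L1-w45a-plan-1 RULING R16.47 (2) «RUNG SUPPLY THEOREM
# `finiteResidualR_hyp_of_isolated` + corollary `fcUnguarded_at_isolated_curve_of_absorbingStep`»; res-L1-w45a-tri-2 PRE-READ 22:08:49Z PASS with
# binder notes (α) `IsRegularLocalRing` currency at the generizations, (β) keep `hcurve` EXPLICIT — the rung is «FC″(loc dim 3) on 4-FOLDS at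
# isolated-curve germs», not a slice of `FCUnguardedLocDimLe3` in all dimensions; seat res-L1-w45a-lead-1 g7)

[OURS · L1 W4.5a] Support file (`--supports stmt-ResolutionOfSingularities-15315 --as helper`); replaces the role of NO printed item — hole-#3
bookkeeping of OURS; NOT a statement of the manuscript; def-free; THEOREMS modulo printed results taken BY NAME as hypotheses
(`CossartPiltant2019General` = CP 2019 Thm. 1.1 (i)(ii); `Stacks081R` = Raynaud–Gruson 1971 Thm. 5.2.2; `CossartPiltant2019Principalization` =
CP 2019 Prop. 4.4; `NonFullLocusClosed` ⟸ Datta–Murayama 2024 Thm. B + EGA IV₂ 6.11.2) and, for the corollary, modulo the CANDIDATE step (T3ᵃ′)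
`AbsorbingStep.AbsorbingClosedPointStepNC` of OURS; AI-written (AI review is weaker than expert review).

THE RUNG (first POSITIVE globalisation theorem of the chain). `X₁` an integral `k`-scheme of finite type (`char k = p`), `η ∈ X₁` a point with
`dim 𝒪_{X₁,η} = 3` whose local ring is NOT regular but all of whose PROPER GENERIZATIONS are regular (an isolated-singularity germ
`Spec 𝒪_{X₁,η}`), such that `X₁` is FULL (domain ∧ CM-clause ∧ F-clause) at every point of an open `V ⊇ C = closure {η}` OFF `C` (res-L1-w45a-tri-2's
neighbourhood-local SCOPE form 22:25:36Z), and every point of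
`C` other than `η` is CLOSED (`C` is a curve — automatic on a 4-fold, NOT on a 5-fold, hence kept explicit). THEN the finite-residual hypothesis of
`RelClosedFixR.FCUnguardedOfFiniteResidualR` holds at `η`: there are an (A′) LocFix datum `c′` at `η`, a centre `J₀` with `J₀,η = (c′)`, a FINITE
closed `Z ∌ η` inside `supp J₀ ⊆ V` with every blow-up along `J₀` good over `V ∖ Z` (`finiteResidualR_hyp_of_isolated`).

PROOF. The 𝔪_η-primary REGULAR local datum `𝔮 = (c′)` of `PrimaryRegularLocFixOfIsolated.exists_primaryRegularLocFix_of_isolated'` (CP's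
one-blowing-up resolution of `Spec 𝒪_η` is supported off the regular punctured spectrum) is spread to a centre `J₀` SUPPORTED INSIDE `C`
(res-L1-w45a-stub-2's `SpreadSupportControl.exists_spread_support_subset_of_le_radical` with `Z := C`: `(I_C)_η ⊆ 𝔪_η ⊆ √𝔮`); then
`supp J₀ = C`, goodness spreads from the stalk to an open `U ∋ η` (res-L1-w45a-stub-1's `DominatingLocFix.goodOver_nhd_of_locGood`), off `C` the
centre is trivial and `X₁` is FULL (`goodOver_top_of_fullCl` + base locality `RelClosedSubsetFixFinite.goodOver_of_stalkIdeal_eq_off_closed`),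
and the residual `Z := C ∖ U` is a closed set of closed points of a Noetherian sober space, hence FINITE
(`ClosedPointsOfClosedFinite.finite_of_isClosed_of_forall_isClosed_singleton`). COROLLARY `fcUnguarded_at_isolatedCurve_of_absorbingStepNC`:
modulo (T3ᵃ′) (res-L1-w45a-stub-1's `AbsorbingClosedPointStepNC`, via `fcUnguardedOfFiniteResidualR_of_absorbingStepNC` p575338) the FC″
conclusion holds at every bad non-closed `η` of this kind — «a 4-fold FULL off a curve `C` and regular at the proper generizations of `η_C`,
F-bad at `η_C`, satisfies FC″ at `η_C` modulo absorbing finitely many closed points of `C`»; `…_of_absorbingStep` for the stronger (T3ᵃ).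
[cite: CossartPiltant2019, Thm. 1.1 (i)(ii); Prop. 4.4] [cite: RaynaudGruson1971, Thm. 5.2.2] [cite: StacksProject, Tag 01J7; Tag 080A]
[cite: DattaMurayama2024, Thm. B]
-/

-- single-problem summit: the doubled namespace component is forced
set_option linter.dupNamespace false

noncomputable section

namespace Summit.ResolutionOfSingularities.ResolutionOfSingularities.Theorems.FInjectiveMacaulayfication.FiniteResidualOfIsolatedGerm

open CategoryTheory CategoryTheory.Limits AlgebraicGeometry TopologicalSpace IsLocalRing
open Literature.AlgebraicGeometry.Resolution Literature.AlgebraicGeometry.CossartPiltant200819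
open Scheme.IdealSheafData
open Summit.ResolutionOfSingularities.ResolutionOfSingularities.Theorems.FInjectiveMacaulayfication
open SliceableCentre FCUnguardedAprime

/-! ## §3 The finite-residual hypothesis at an isolated-singularity CURVE germ -/

/-- Blow-ups along the TRIVIAL centre `⊤` are good over the FULL locus: such a blow-up is an isomorphism. [plumbing] -/
theorem goodOver_top_of_fullCl {X₁ : Scheme.{0}} (p : ℕ) {S : Set X₁} (hS : ∀ x ∈ S, FullCl p (X₁.presheaf.stalk x)) :
    GoodOver p X₁ ⊤ S := by
  intro X₂ π hπ
  obtain ⟨e, he, -⟩ := (isBlowup_id_top X₁).unique hπ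
  haveI : IsIso π := by
    have hπe : π = e.inv := by
      rw [← Category.comp_id e.inv, ← he, Iso.inv_hom_id_assoc]
    rw [hπe]
    infer_instance
  have hfull : ∀ x : X₂, π.base x ∈ S → FullCl p (X₂.presheaf.stalk x) := fun x hx =>
    WFixAtNonClosedDimTwo.fullCl_of_ringEquiv p (asIso (π.stalkMap x)).commRingCatIsoToRingEquiv (hS _ hx)
  exact ⟨fun x hx _ => hfull x hx, fun x hx _ => RelClosedSubsetFixFinite.cmCl_of_fullCl (hfull x hx)⟩

/-- **RUNG SUPPLY THEOREM (R16.47 (2)).** At a point `η` with `dim 𝒪_{X₁,η} = 3`, `𝒪_{X₁,η}` not regular, regular proper generizations,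
`X₁` FULL on `V ∖ C` for an open `V ⊇ C := closure {η}` and every point of `C ∖ {η}` closed, the FINITE-RESIDUAL HYPOTHESIS of
`RelClosedFixR.FCUnguardedOfFiniteResidualR` holds at `η`: an (A′) LocFix datum `c′`, a centre `J₀` with `J₀,η = (c′)`, and a FINITE closed
`Z ∌ η`, `Z ⊆ supp J₀ ⊆ V`, with every blow-up along `J₀` good over `V ∖ Z` (here `supp J₀ = C`, `Z = C ∖ U`). Modulo CP 2019
Thm. 1.1 + Raynaud–Gruson + CP 2019 Prop. 4.4 and `NonFullLocusClosed` BY NAME. [OURS · conditional-result]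
[cite: CossartPiltant2019, Thm. 1.1 (i)(ii); Prop. 4.4] [cite: DattaMurayama2024, Thm. B] [cite: StacksProject, Tag 01J7] -/
theorem finiteResidualR_hyp_of_isolated
    (hG : CossartPiltant2019General.{0}) (h081R : Stacks081R.{0}) (hP : CossartPiltant2019Principalization.{0})
    (hNF : NonFullLocusClosed.NonFullLocusClosed)
    (p : ℕ) (hp : p.Prime) (k : Type) [Field k] [CharP k p] (X₁ : Scheme.{0}) (f₁ : X₁ ⟶ Spec (.of k))
    [LocallyOfFiniteType f₁] [QuasiCompact f₁] [IsIntegral X₁]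
    (η : X₁) (hdim : ringKrullDim (X₁.presheaf.stalk η) = 3) (hsing : ¬ IsRegularLocalRing (X₁.presheaf.stalk η))
    (hreg : ∀ x : X₁, x ⤳ η → x ≠ η → IsRegularLocalRing (X₁.presheaf.stalk x))
    (V : X₁.Opens) (hCV : closure ({η} : Set X₁) ⊆ (V : Set X₁))
    (hfull : ∀ x : X₁, x ∈ (V : Set X₁) → x ∉ closure ({η} : Set X₁) → FullCl p (X₁.presheaf.stalk x))
    (hcurve : ∀ x : X₁, x ∈ closure ({η} : Set X₁) → x ≠ η → IsClosed ({x} : Set X₁)) :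
    ∃ (n' : ℕ) (c' : Fin n' → X₁.presheaf.stalk η) (J₀ : X₁.IdealSheafData) (V : X₁.Opens) (Z : Set X₁),
      LocFixData p X₁ η n' c' ∧ stalkIdeal J₀ η = Ideal.span (Set.range c') ∧ IsClosed Z ∧ Z.Finite ∧ η ∉ Z ∧
        Z ⊆ (J₀.support : Set X₁) ∧ (J₀.support : Set X₁) ⊆ (V : Set X₁) ∧ GoodOver p X₁ J₀ ((V : Set X₁) \ Z) := by
  classical
  haveI : Fact p.Prime := ⟨hp⟩
  haveI : IsNoetherian X₁ := ClosedPointsOfClosedFinite.isNoetherian_of_locallyOfFiniteType_of_quasiCompact f₁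
  haveI : JacobsonSpace X₁ := LocallyOfFiniteType.jacobsonSpace f₁
  -- the 𝔪_η-primary regular LocFix datum (`PrimaryRegularLocFixOfIsolated`)
  obtain ⟨n', c', hne, hle, hrad, hcharts⟩ := PrimaryRegularLocFixOfIsolated.exists_primaryRegularLocFix_of_isolated' hG h081R hP p f₁ η hdim hsing hreg
  -- spread it to a centre `J₀` supported inside `C := closure {η}`
  have hC : IsClosed (closure ({η} : Set X₁)) := isClosed_closure
  have hηC : η ∈ closure ({η} : Set X₁) := subset_closure (Set.mem_singleton η)
  have hIC : stalkIdeal (vanishingIdeal ⟨closure ({η} : Set X₁), hC⟩) η ≤ (Ideal.span (Set.range c')).radical := by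
    refine le_trans (IsLocalRing.le_maximalIdeal ?_) hrad
    rw [← mem_support_iff_stalkIdeal_ne_top]
    show η ∈ ((vanishingIdeal ⟨closure ({η} : Set X₁), hC⟩).support : Set X₁)
    rw [Scheme.IdealSheafData.coe_support_vanishingIdeal]
    exact hηC
  obtain ⟨J₀, hJ₀η, hJ₀C⟩ := SpreadSupportControl.exists_spread_support_subset_of_le_radical (closure ({η} : Set X₁)) hC c' hIC
  have hJ₀ : J₀ ≠ ⊥ := by
    intro h
    apply hne
    rw [← hJ₀η, h]
    exact stalkIdeal_bot η
  have hηJ₀ : η ∈ (J₀.support : Set X₁) := by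
    show η ∈ J₀.support
    rw [mem_support_iff_stalkIdeal_ne_top, hJ₀η]
    exact fun htop => (IsLocalRing.maximalIdeal.isMaximal (X₁.presheaf.stalk η)).ne_top (top_le_iff.mp (htop ▸ hle))
  have hsuppC : (J₀.support : Set X₁) = closure ({η} : Set X₁) :=
    Set.Subset.antisymm hJ₀C (closure_minimal (Set.singleton_subset_iff.mpr hηJ₀) J₀.support.isClosed)
  -- goodness near `η`
  obtain ⟨U, hηU, -, hgoodU⟩ := DominatingLocFix.goodOver_nhd_of_locGood hNF p hp k X₁ f₁ J₀ hJ₀ η c' hJ₀η.symm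
    (fun j 𝔔 _ => (hcharts j 𝔔).2)
  -- goodness off `C`: the centre is trivial there and `X₁` is FULL
  have hgoodOff : GoodOver p X₁ J₀ (((V : Set X₁) \ closure ({η} : Set X₁)) \ closure ({η} : Set X₁)) :=
    RelClosedSubsetFixFinite.goodOver_of_stalkIdeal_eq_off_closed (J := J₀) (J₀ := ⊤) hC
      (fun x hx => by
        rw [stalkIdeal_top]
        exact stalkIdeal_eq_top_of_not_mem_support (fun h => hx (hJ₀C h)))
      (goodOver_top_of_fullCl p (fun x hx => hfull x hx.1 hx.2))
  -- the residual `Z := C ∖ U`: closed, of closed points, finite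
  refine ⟨n', c', J₀, V, closure ({η} : Set X₁) \ (U : Set X₁), ⟨hne, hle, fun j 𝔔 _ => (hcharts j 𝔔).2⟩, hJ₀η,
    hC.sdiff U.isOpen, ?_, fun h => h.2 hηU, ?_, by rw [hsuppC]; exact hCV, ?_⟩
  · exact ClosedPointsOfClosedFinite.finite_of_isClosed_of_forall_isClosed_singleton (hC.sdiff U.isOpen)
      (fun x hx => hcurve x hx.1 (fun hxη => hx.2 (hxη ▸ hηU)))
  · rw [hsuppC]
    exact fun x hx => hx.1
  · refine RelClosedSubsetFixFinite.goodOver_mono ?_ (RelClosedFixR.goodOver_union hgoodOff hgoodU)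
    intro x hx
    by_cases hxC : x ∈ closure ({η} : Set X₁)
    · right
      by_contra hxU
      exact hx.2 ⟨hxC, hxU⟩
    · exact Or.inl ⟨⟨hx.1, hxC⟩, hxC⟩

/-- Regular ⇒ not bad: a regular stalk of a `k`-scheme of characteristic `p` satisfies the F-clause. [plumbing, via `RegularPointClause`] -/
theorem not_isRegularLocalRing_of_not_fCl (p : ℕ) [Fact p.Prime] {k : Type} [Field k] [CharP k p]
    {X : Scheme.{0}} (f : X ⟶ Spec (.of k)) (x : X) (hbad : ¬ FCl p (X.presheaf.stalk x)) :
    ¬ IsRegularLocalRing (X.presheaf.stalk x) := fun hx =>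
  hbad fun d hd s hs => ((RegularPointClause.fiClause_stalk_of_isRegularLocalRing p f x hx).2 d hd s hs).2

/-! ## §4 COROLLARY: FC″ at isolated-singularity curve germs, modulo the absorbing closed-point step (T3ᵃ′) -/

/-- **FC″ AT ISOLATED-SINGULARITY CURVE GERMS, modulo (T3ᵃ′).** Assume res-L1-w45a-stub-1's candidate step `AbsorbingClosedPointStepNC`. Let `X₁`
be an integral separated `k`-scheme of finite type of dimension `≥ 4` with Cohen–Macaulay stalks (clause sense), `η` a NON-closed F-BAD point
with good proper generizations (the binders of FC″), `dim 𝒪_{X₁,η} = 3`, REGULAR proper generizations, `X₁` FULL off `C = closure {η}` and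
`C ∖ {η}` consisting of closed points (`V ⊇ C` open, `X₁` FULL on `V ∖ C`). Then the conclusion of FC″ holds at `η`: a centre `J ∋ η` with a re-chosen (A′) datum at `η` whose every
blow-up is FULL at the non-closed and CM at the closed points over `supp J`. («A 4-fold FULL off a curve `C`, regular at the proper
generizations of `η_C`, F-bad at `η_C`, satisfies FC″ at `η_C` — modulo absorbing finitely many closed points of `C`.»)
[OURS · conditional on the CANDIDATE (T3ᵃ′) and on CP 1.1 / R–G / CP 4.4 / `NonFullLocusClosed` BY NAME]
[cite: CossartPiltant2019, Thm. 1.1 (i)(ii); Prop. 4.4] [cite: DattaMurayama2024, Thm. B] -/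
theorem fcUnguarded_at_isolatedCurve_of_absorbingStepNC (h : AbsorbingStep.AbsorbingClosedPointStepNC)
    (hG : CossartPiltant2019General.{0}) (h081R : Stacks081R.{0}) (hP : CossartPiltant2019Principalization.{0})
    (hNF : NonFullLocusClosed.NonFullLocusClosed)
    (p : ℕ) (hp : p.Prime) (k : Type) [Field k] [CharP k p] (X₁ : Scheme.{0}) (f₁ : X₁ ⟶ Spec (.of k))
    (hs : IsSeparated f₁) (hft : LocallyOfFiniteType f₁) (hqc : QuasiCompact f₁) (hi : IsIntegral X₁) (h4 : 4 ≤ topologicalKrullDim X₁)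
    (hCM : ∀ x : X₁, (∀ d : ℕ, ringKrullDim (X₁.presheaf.stalk x) = d → ∀ s : Fin d → X₁.presheaf.stalk x,
        (Ideal.span (Set.range s)).radical.IsMaximal → RingTheory.Sequence.IsWeaklyRegular (X₁.presheaf.stalk x) (List.ofFn s)))
    (η : X₁)
    (hη : ¬ IsClosed ({η} : Set X₁) ∧ ¬ (∀ d : ℕ, ringKrullDim (X₁.presheaf.stalk η) = d → ∀ s : Fin d → X₁.presheaf.stalk η,
          (Ideal.span (Set.range s)).radical.IsMaximal → ∀ t : X₁.presheaf.stalk η, (∃ e : ℕ, t ^ p ^ e ∈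
            Ideal.span ((fun z : X₁.presheaf.stalk η => z ^ p ^ e) '' (Ideal.span (Set.range s) : Set (X₁.presheaf.stalk η)))) →
              t ∈ Ideal.span (Set.range s)) ∧
        ∀ y : X₁, y ⤳ η → y ≠ η → (∀ d : ℕ, ringKrullDim (X₁.presheaf.stalk y) = d → ∀ s : Fin d → X₁.presheaf.stalk y,
          (Ideal.span (Set.range s)).radical.IsMaximal → ∀ t : X₁.presheaf.stalk y, (∃ e : ℕ, t ^ p ^ e ∈
            Ideal.span ((fun z : X₁.presheaf.stalk y => z ^ p ^ e) '' (Ideal.span (Set.range s) : Set (X₁.presheaf.stalk y)))) →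
              t ∈ Ideal.span (Set.range s)))
    (hdim : ringKrullDim (X₁.presheaf.stalk η) = 3)
    (hreg : ∀ x : X₁, x ⤳ η → x ≠ η → IsRegularLocalRing (X₁.presheaf.stalk x))
    (V : X₁.Opens) (hCV : closure ({η} : Set X₁) ⊆ (V : Set X₁))
    (hfull : ∀ x : X₁, x ∈ (V : Set X₁) → x ∉ closure ({η} : Set X₁) → FullCl p (X₁.presheaf.stalk x))
    (hcurve : ∀ x : X₁, x ∈ closure ({η} : Set X₁) → x ≠ η → IsClosed ({x} : Set X₁)) :
    ∃ (J : X₁.IdealSheafData) (n' : ℕ) (c' : Fin n' → X₁.presheaf.stalk η), J ≠ ⊥ ∧ η ∈ (J.support : Set X₁) ∧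
      Ideal.span (Set.range c') ≠ ⊥ ∧ Ideal.span (Set.range c') ≤ maximalIdeal (X₁.presheaf.stalk η) ∧
        (∀ (j : Fin n') (𝔔 : PrimeSpectrum (blowupAlgebra (Ideal.span (Set.range c')) (c' j))),
          𝔔.asIdeal.comap (algebraMap (X₁.presheaf.stalk η) (blowupAlgebra (Ideal.span (Set.range c')) (c' j))) =
            maximalIdeal (X₁.presheaf.stalk η) →
          IsDomain (Localization.AtPrime 𝔔.asIdeal) ∧ ∀ d : ℕ, ringKrullDim (Localization.AtPrime 𝔔.asIdeal) = d →
            ∀ s : Fin d → Localization.AtPrime 𝔔.asIdeal, (Ideal.span (Set.range s)).radical.IsMaximal →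
              RingTheory.Sequence.IsWeaklyRegular (Localization.AtPrime 𝔔.asIdeal) (List.ofFn s) ∧
              ∀ y : Localization.AtPrime 𝔔.asIdeal, (∃ e : ℕ, y ^ p ^ e ∈ Ideal.span ((fun z : Localization.AtPrime 𝔔.asIdeal => z ^ p ^ e) ''
                (Ideal.span (Set.range s) : Set (Localization.AtPrime 𝔔.asIdeal)))) → y ∈ Ideal.span (Set.range s)) ∧
      stalkIdeal J η = Ideal.span (Set.range c') ∧
      (∀ (X₂ : Scheme.{0}) (π : X₂ ⟶ X₁), IsBlowup π J →
        (∀ x : X₂, π.base x ∈ (J.support : Set X₁) → π.base x ≠ η → ¬ IsClosed ({x} : Set X₂) →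
          IsDomain (X₂.presheaf.stalk x) ∧ ∀ d : ℕ, ringKrullDim (X₂.presheaf.stalk x) = d → ∀ s : Fin d → X₂.presheaf.stalk x,
            (Ideal.span (Set.range s)).radical.IsMaximal → RingTheory.Sequence.IsWeaklyRegular (X₂.presheaf.stalk x) (List.ofFn s) ∧
            ∀ t : X₂.presheaf.stalk x, (∃ e : ℕ, t ^ p ^ e ∈ Ideal.span ((fun z : X₂.presheaf.stalk x => z ^ p ^ e) ''
              (Ideal.span (Set.range s) : Set (X₂.presheaf.stalk x)))) → t ∈ Ideal.span (Set.range s)) ∧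
        (∀ x : X₂, π.base x ∈ (J.support : Set X₁) → IsClosed ({x} : Set X₂) →
          ∀ d : ℕ, ringKrullDim (X₂.presheaf.stalk x) = d → ∀ s : Fin d → X₂.presheaf.stalk x,
            (Ideal.span (Set.range s)).radical.IsMaximal → RingTheory.Sequence.IsWeaklyRegular (X₂.presheaf.stalk x) (List.ofFn s))) := by
  haveI : Fact p.Prime := ⟨hp⟩
  haveI := hft
  haveI := hqc
  haveI := hi
  have hsing : ¬ IsRegularLocalRing (X₁.presheaf.stalk η) := not_isRegularLocalRing_of_not_fCl p f₁ η hη.2.1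
  exact AbsorbingStep.fcUnguardedOfFiniteResidualR_of_absorbingStepNC h p hp k X₁ f₁ hs hft hqc hi h4 hCM η hη
    (finiteResidualR_hyp_of_isolated hG h081R hP hNF p hp k X₁ f₁ η hdim hsing hreg V hCV hfull hcurve)

/-- The same modulo the stronger step (T3ᵃ) `AbsorbingClosedPointStep` of record (res-L1-w45a-plan-1 R16.36; it implies (T3ᵃ′),
`AbsorbingStep.absorbingStepNC_of_step`). [OURS · conditional on the CANDIDATE (T3ᵃ) and on the printed facts BY NAME] -/
theorem fcUnguarded_at_isolatedCurve_of_absorbingStep (h : AbsorbingStep.AbsorbingClosedPointStep)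
    (hG : CossartPiltant2019General.{0}) (h081R : Stacks081R.{0}) (hP : CossartPiltant2019Principalization.{0})
    (hNF : NonFullLocusClosed.NonFullLocusClosed)
    (p : ℕ) (hp : p.Prime) (k : Type) [Field k] [CharP k p] (X₁ : Scheme.{0}) (f₁ : X₁ ⟶ Spec (.of k))
    (hs : IsSeparated f₁) (hft : LocallyOfFiniteType f₁) (hqc : QuasiCompact f₁) (hi : IsIntegral X₁) (h4 : 4 ≤ topologicalKrullDim X₁)
    (hCM : ∀ x : X₁, (∀ d : ℕ, ringKrullDim (X₁.presheaf.stalk x) = d → ∀ s : Fin d → X₁.presheaf.stalk x,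
        (Ideal.span (Set.range s)).radical.IsMaximal → RingTheory.Sequence.IsWeaklyRegular (X₁.presheaf.stalk x) (List.ofFn s)))
    (η : X₁)
    (hη : ¬ IsClosed ({η} : Set X₁) ∧ ¬ (∀ d : ℕ, ringKrullDim (X₁.presheaf.stalk η) = d → ∀ s : Fin d → X₁.presheaf.stalk η,
          (Ideal.span (Set.range s)).radical.IsMaximal → ∀ t : X₁.presheaf.stalk η, (∃ e : ℕ, t ^ p ^ e ∈
            Ideal.span ((fun z : X₁.presheaf.stalk η => z ^ p ^ e) '' (Ideal.span (Set.range s) : Set (X₁.presheaf.stalk η)))) →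
              t ∈ Ideal.span (Set.range s)) ∧
        ∀ y : X₁, y ⤳ η → y ≠ η → (∀ d : ℕ, ringKrullDim (X₁.presheaf.stalk y) = d → ∀ s : Fin d → X₁.presheaf.stalk y,
          (Ideal.span (Set.range s)).radical.IsMaximal → ∀ t : X₁.presheaf.stalk y, (∃ e : ℕ, t ^ p ^ e ∈
            Ideal.span ((fun z : X₁.presheaf.stalk y => z ^ p ^ e) '' (Ideal.span (Set.range s) : Set (X₁.presheaf.stalk y)))) →
              t ∈ Ideal.span (Set.range s)))
    (hdim : ringKrullDim (X₁.presheaf.stalk η) = 3)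
    (hreg : ∀ x : X₁, x ⤳ η → x ≠ η → IsRegularLocalRing (X₁.presheaf.stalk x))
    (V : X₁.Opens) (hCV : closure ({η} : Set X₁) ⊆ (V : Set X₁))
    (hfull : ∀ x : X₁, x ∈ (V : Set X₁) → x ∉ closure ({η} : Set X₁) → FullCl p (X₁.presheaf.stalk x))
    (hcurve : ∀ x : X₁, x ∈ closure ({η} : Set X₁) → x ≠ η → IsClosed ({x} : Set X₁)) :
    ∃ (J : X₁.IdealSheafData) (n' : ℕ) (c' : Fin n' → X₁.presheaf.stalk η), J ≠ ⊥ ∧ η ∈ (J.support : Set X₁) ∧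
      Ideal.span (Set.range c') ≠ ⊥ ∧ Ideal.span (Set.range c') ≤ maximalIdeal (X₁.presheaf.stalk η) ∧
        (∀ (j : Fin n') (𝔔 : PrimeSpectrum (blowupAlgebra (Ideal.span (Set.range c')) (c' j))),
          𝔔.asIdeal.comap (algebraMap (X₁.presheaf.stalk η) (blowupAlgebra (Ideal.span (Set.range c')) (c' j))) =
            maximalIdeal (X₁.presheaf.stalk η) →
          IsDomain (Localization.AtPrime 𝔔.asIdeal) ∧ ∀ d : ℕ, ringKrullDim (Localization.AtPrime 𝔔.asIdeal) = d →
            ∀ s : Fin d → Localization.AtPrime 𝔔.asIdeal, (Ideal.span (Set.range s)).radical.IsMaximal →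
              RingTheory.Sequence.IsWeaklyRegular (Localization.AtPrime 𝔔.asIdeal) (List.ofFn s) ∧
              ∀ y : Localization.AtPrime 𝔔.asIdeal, (∃ e : ℕ, y ^ p ^ e ∈ Ideal.span ((fun z : Localization.AtPrime 𝔔.asIdeal => z ^ p ^ e) ''
                (Ideal.span (Set.range s) : Set (Localization.AtPrime 𝔔.asIdeal)))) → y ∈ Ideal.span (Set.range s)) ∧
      stalkIdeal J η = Ideal.span (Set.range c') ∧
      (∀ (X₂ : Scheme.{0}) (π : X₂ ⟶ X₁), IsBlowup π J →
        (∀ x : X₂, π.base x ∈ (J.support : Set X₁) → π.base x ≠ η → ¬ IsClosed ({x} : Set X₂) →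
          IsDomain (X₂.presheaf.stalk x) ∧ ∀ d : ℕ, ringKrullDim (X₂.presheaf.stalk x) = d → ∀ s : Fin d → X₂.presheaf.stalk x,
            (Ideal.span (Set.range s)).radical.IsMaximal → RingTheory.Sequence.IsWeaklyRegular (X₂.presheaf.stalk x) (List.ofFn s) ∧
            ∀ t : X₂.presheaf.stalk x, (∃ e : ℕ, t ^ p ^ e ∈ Ideal.span ((fun z : X₂.presheaf.stalk x => z ^ p ^ e) ''
              (Ideal.span (Set.range s) : Set (X₂.presheaf.stalk x)))) → t ∈ Ideal.span (Set.range s)) ∧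
        (∀ x : X₂, π.base x ∈ (J.support : Set X₁) → IsClosed ({x} : Set X₂) →
          ∀ d : ℕ, ringKrullDim (X₂.presheaf.stalk x) = d → ∀ s : Fin d → X₂.presheaf.stalk x,
            (Ideal.span (Set.range s)).radical.IsMaximal → RingTheory.Sequence.IsWeaklyRegular (X₂.presheaf.stalk x) (List.ofFn s))) :=
  fcUnguarded_at_isolatedCurve_of_absorbingStepNC (AbsorbingStep.absorbingStepNC_of_step h) hG h081R hP hNF p hp k X₁ f₁ hs hft hqc hi h4
    hCM η hη hdim hreg V hCV hfull hcurve

end Summit.ResolutionOfSingularities.ResolutionOfSingularities.Theorems.FInjectiveMacaulayfication.FiniteResidualOfIsolatedGerm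

end
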